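import Summits.Parity.GeneralizedHardyLittlewood.Theses.ParityLeakOneFifth
import Summits.Parity.GeneralizedHardyLittlewood.Statement

/-!
# SkelVet reconstruction of the registered BC3 birth skeleton of `CalibratedE1` (stmt-Parity-18379)

The registered file (sha 2ea26e63…, planner-type-54e515b4a7-0, stubs `stub_low`, `stub_high`, `stub_split`)
is not readable from a seat jail. This is a FAITHFUL STAND-IN built from the registered stub signatures
(`stub_low : CalibratedE1Low`, `stub_high : CalibratedE1High`,
`stub_split : CalibratedE1Low → CalibratedE1High → Named.CalibratedE1'`) and the route's TWO-LAYER PLAN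
(Theses/ParityLeakOneFifth.lean, docstring: "CalibratedE1 ⇐ CalibratedE1Low (window [x^{ε²}, x^{1/14}) …)
→ CalibratedE1High (window [x^{1/14}, x^{1/5}): the research core) → split"), in the NATURAL reading:
`CalibratedE1Low/High` = the crux's calibrated functional with the type function Φ restricted to the
least-prime-factor window [x^{ε²}, x^{1/14}) resp. [x^{1/14}, x^{1/5}); `Named.CalibratedE1'` = the crux restated
through named definitions. It is NOT the registered artefact.

Finding of this file: in the natural reading the registered glue stub `stub_split` is a THEOREM (proved below,
≈ 40 lines: additivity of the calibrated functional `F_x(Φ) = W_Φ − (Π_Φ/B)·W_λ` in `Φ`, the pointwise split of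
the least-prime-factor window at `x^{1/14}`, monotonicity of `x ↦ x^t` in the exponent for `x ≥ 1`, and
`θ/2 + θ/2`), so the skeleton's content is exactly the two band stubs `stub_low`, `stub_high`, and
`CalibratedE1_of` below is a real assembly `stub_low → stub_high → CalibratedE1` (sorries: 2, in the band stubs).
-/

namespace Summit.Parity.GeneralizedHardyLittlewood.Cruxes.CalibratedE1.SkelVet

open scoped BigOperators
open Summit.Parity.GeneralizedHardyLittlewood.Theses.ParityLeakOneFifth

noncomputable section

namespace Named

/-- `z = exp((log log x)²)`. -/
def z (x : ℕ) : ℝ := Real.exp (Real.log (Real.log (x : ℝ)) ^ 2)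

/-- `V(z) = ∏_{p < z} (1 - 1/p)`. -/
def V (x : ℕ) : ℝ := ∏ p ∈ (Finset.range ⌈z x⌉₊).filter Nat.Prime, (1 - 1 / (p : ℝ))

/-- the z-rough model `b_n = 1[P⁻(n) ≥ z] / V(z)` (evaluated at `n + 2` by the caller, as in the crux). -/
def b (x : ℕ) : ℕ → ℝ := fun n => if ∀ p ∈ n.primeFactors, z x ≤ (p : ℝ) then 1 / V x else 0

/-- the host `a_n = Λ'(n)`. -/
def a : ℕ → ℝ := fun n => if n.Prime then Real.log (n : ℝ) else 0

/-- the (W1)@1/5 type function on the least-prime-factor window `[x^lo, x^hi)`. -/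
def Φw (x : ℕ) (ε lo hi : ℝ) : ℕ → ℝ := fun m =>
  if (x : ℝ) ^ lo ≤ (m.minFac : ℝ) ∧ (m.minFac : ℝ) < (x : ℝ) ^ hi then
    ∑ d ∈ (Nat.divisors m).filter (fun d : ℕ => (d : ℝ) ≤ (x : ℝ) ^ ((1 : ℝ) / 2 - 2 * ε) ∧
        ∀ p ∈ d.primeFactors, (x : ℝ) ^ ((1 : ℝ) / 5) ≤ (p : ℝ)), (ArithmeticFunction.moebius d : ℝ)
  else 0

/-- `W_Φ = Σ Φ(n+2) (a_n − b_n)`. -/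
def WPhi (x : ℕ) (Φ : ℕ → ℝ) : ℝ := ∑ n ∈ Finset.Ioc x (2 * x), Φ (n + 2) * (a n - b x n)

/-- `Π_Φ = Σ b_n λ(n+2) Φ(n+2)`. -/
def PiΦ (x : ℕ) (Φ : ℕ → ℝ) : ℝ :=
  ∑ n ∈ Finset.Ioc x (2 * x), b x n * (ArithmeticFunction.liouville (n + 2) : ℝ) * Φ (n + 2)

/-- `B = Σ b_n`. -/
def B (x : ℕ) : ℝ := ∑ n ∈ Finset.Ioc x (2 * x), b x n

/-- `W_λ = Σ λ(n+2) (a_n − b_n)`. -/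
def Wlam (x : ℕ) : ℝ := ∑ n ∈ Finset.Ioc x (2 * x), (ArithmeticFunction.liouville (n + 2) : ℝ) * (a n - b x n)

/-- the calibrated functional `F_x(Φ) = W_Φ − (Π_Φ / B) · W_λ` (`t₁ = Π_Φ / B`). -/
def F (x : ℕ) (Φ : ℕ → ℝ) : ℝ := WPhi x Φ - PiΦ x Φ / B x * Wlam x

/-- K2 with the type function supported on the least-prime-factor window `[x^{lo ε}, x^{hi ε})`. -/
def CalibratedE1Window (lo hi : ℝ → ℝ) : Prop :=
  ∃ ε₁ : ℝ, 0 < ε₁ ∧ ∀ ε : ℝ, 0 < ε → ε ≤ ε₁ → ∀ θ : ℝ, 0 < θ → ∃ x₀ : ℕ, ∀ x : ℕ, x₀ ≤ x →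
    F x (Φw x ε (lo ε) (hi ε)) ≤ θ * (x : ℝ) / Real.log (x : ℝ)

/-- the crux `CalibratedE1` restated through the named definitions (window `[x^{ε²}, x^{1/5})`). -/
def CalibratedE1' : Prop := CalibratedE1Window (fun ε => ε ^ 2) (fun _ => (1 : ℝ) / 5)

end Named

/-- LOW band: least prime factor of `m = n + 2` in `[x^{ε²}, x^{1/14})` (BFI Thm 10 at level 4/7 = 1/2 + 1/14). -/
def CalibratedE1Low : Prop := Named.CalibratedE1Window (fun ε => ε ^ 2) (fun _ => (1 : ℝ) / 14)

/-- HIGH band: least prime factor of `m = n + 2` in `[x^{1/14}, x^{1/5})` ("the research core"). -/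
def CalibratedE1High : Prop := Named.CalibratedE1Window (fun _ => (1 : ℝ) / 14) (fun _ => (1 : ℝ) / 5)


/-! ## Linearity lemmas: the glue stub `stub_split` is a theorem in the natural reading -/

namespace Named

lemma WPhi_add (x : ℕ) (Φ₁ Φ₂ : ℕ → ℝ) :
    WPhi x (fun m => Φ₁ m + Φ₂ m) = WPhi x Φ₁ + WPhi x Φ₂ := by
  unfold WPhi
  rw [← Finset.sum_add_distrib]
  exact Finset.sum_congr rfl fun n _ => by ring

lemma PiΦ_add (x : ℕ) (Φ₁ Φ₂ : ℕ → ℝ) :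
    PiΦ x (fun m => Φ₁ m + Φ₂ m) = PiΦ x Φ₁ + PiΦ x Φ₂ := by
  unfold PiΦ
  rw [← Finset.sum_add_distrib]
  exact Finset.sum_congr rfl fun n _ => by ring

/-- `F_x` is additive in the type function (the calibration `t₁ = Π_Φ / B` is linear in `Φ`). -/
lemma F_add (x : ℕ) (Φ₁ Φ₂ : ℕ → ℝ) :
    F x (fun m => Φ₁ m + Φ₂ m) = F x Φ₁ + F x Φ₂ := by
  unfold F
  rw [WPhi_add, PiΦ_add, add_div]
  ring

/-- the window `[x^lo, x^hi)` splits at `x^mid` pointwise. -/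
lemma Φw_split (x : ℕ) (ε lo mid hi : ℝ) (h₁ : (x : ℝ) ^ lo ≤ (x : ℝ) ^ mid)
    (h₂ : (x : ℝ) ^ mid ≤ (x : ℝ) ^ hi) :
    Φw x ε lo hi = fun m => Φw x ε lo mid m + Φw x ε mid hi m := by
  funext m
  unfold Φw
  by_cases hA : (x : ℝ) ^ mid ≤ (m.minFac : ℝ)
  · have hn : ¬ ((x : ℝ) ^ lo ≤ (m.minFac : ℝ) ∧ (m.minFac : ℝ) < (x : ℝ) ^ mid) :=
      fun h => (not_lt.mpr hA) h.2
    rw [if_neg hn, zero_add]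
    by_cases hB : (m.minFac : ℝ) < (x : ℝ) ^ hi
    · rw [if_pos ⟨h₁.trans hA, hB⟩, if_pos ⟨hA, hB⟩]
    · rw [if_neg (fun h => hB h.2), if_neg (fun h => hB h.2)]
  · rw [not_le] at hA
    have hn : ¬ ((x : ℝ) ^ mid ≤ (m.minFac : ℝ) ∧ (m.minFac : ℝ) < (x : ℝ) ^ hi) :=
      fun h => (not_le.mpr hA) h.1
    rw [if_neg hn, add_zero]
    by_cases hC : (x : ℝ) ^ lo ≤ (m.minFac : ℝ)
    · rw [if_pos ⟨hC, hA.trans_le h₂⟩, if_pos ⟨hC, hA⟩]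
    · rw [if_neg (fun h => hC h.1), if_neg (fun h => hC h.1)]

end Named

/-- registered band stub (LOW band `[x^{ε²}, x^{1/14})`): the BFI-level-4/7 input; OPEN. -/
theorem stub_low : CalibratedE1Low := by
  sorry

/-- registered band stub (HIGH band `[x^{1/14}, x^{1/5})`): "the research core"; OPEN. -/
theorem stub_high : CalibratedE1High := by
  sorry

/-- registered glue stub `stub_split`, here PROVED (natural reading): Low(θ/2) + High(θ/2) ⇒ K2(θ), for ε ≤ min(ε₁ᴸ, ε₁ᴴ, 1/4)
(so that `x^{ε²} ≤ x^{1/14} ≤ x^{1/5}` for `x ≥ 1`). -/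
theorem stub_split : CalibratedE1Low → CalibratedE1High → Named.CalibratedE1' := by
  rintro ⟨e1, he1, hl⟩ ⟨e2, he2, hh⟩
  refine ⟨min (min e1 e2) (1 / 4), lt_min (lt_min he1 he2) (by norm_num), fun ε hε hεε θ hθ => ?_⟩
  have hε1 : ε ≤ e1 := hεε.trans ((min_le_left _ _).trans (min_le_left _ _))
  have hε2 : ε ≤ e2 := hεε.trans ((min_le_left _ _).trans (min_le_right _ _))
  have hε4 : ε ≤ 1 / 4 := hεε.trans (min_le_right _ _)
  obtain ⟨x₁, hx₁⟩ := hl ε hε hε1 (θ / 2) (half_pos hθ)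
  obtain ⟨x₂, hx₂⟩ := hh ε hε hε2 (θ / 2) (half_pos hθ)
  refine ⟨max (max x₁ x₂) 1, fun x hx => ?_⟩
  have hx1 : x₁ ≤ x := le_trans (le_trans (le_max_left _ _) (le_max_left _ _)) hx
  have hx2 : x₂ ≤ x := le_trans (le_trans (le_max_right _ _) (le_max_left _ _)) hx
  have hxone : (1 : ℝ) ≤ (x : ℝ) := by exact_mod_cast le_trans (le_max_right _ _) hx
  have hexp1 : ε ^ 2 ≤ (1 : ℝ) / 14 := by nlinarith
  have hexp2 : (1 : ℝ) / 14 ≤ (1 : ℝ) / 5 := by norm_num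
  have hmono1 : (x : ℝ) ^ (ε ^ 2) ≤ (x : ℝ) ^ ((1 : ℝ) / 14) :=
    Real.rpow_le_rpow_of_exponent_le hxone hexp1
  have hmono2 : (x : ℝ) ^ ((1 : ℝ) / 14) ≤ (x : ℝ) ^ ((1 : ℝ) / 5) :=
    Real.rpow_le_rpow_of_exponent_le hxone hexp2
  have h1 := hx₁ x hx1
  have h2 := hx₂ x hx2
  simp only [] at h1 h2 ⊢
  rw [Named.Φw_split x ε (ε ^ 2) ((1 : ℝ) / 14) ((1 : ℝ) / 5) hmono1 hmono2, Named.F_add]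
  have hsum : θ / 2 * (x : ℝ) / Real.log (x : ℝ) + θ / 2 * (x : ℝ) / Real.log (x : ℝ)
      = θ * (x : ℝ) / Real.log (x : ℝ) := by ring
  linarith

/-- The assembly: concludes the crux BY NAME from the registered stubs (real proof term; the only
`sorry`s in this file are `stub_low`, `stub_high`). -/
theorem CalibratedE1_of : CalibratedE1 := by
  obtain ⟨ε₁, hε₁, h⟩ := stub_split stub_low stub_high
  refine ⟨ε₁, hε₁, fun ε hε hεε θ hθ => ?_⟩
  obtain ⟨x₀, hx⟩ := h ε hε hεε θ hθ
  refine ⟨x₀, fun x hx' => ?_⟩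
  have := hx x hx'
  simpa only [Named.F, Named.WPhi, Named.PiΦ, Named.B, Named.Wlam, Named.Φw, Named.a, Named.b, Named.V,
    Named.z] using this

end

end Summit.Parity.GeneralizedHardyLittlewood.Cruxes.CalibratedE1.SkelVet
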